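import Summits.CriticalPhenomena.PercolationContinuityZ3.Theorems.PercNearOneGluingNoHeavyConstsMDLXJointMarkerLattice
import HarnessLib

/-!
# MDL(X)′ for every monotone marker-measurable functional (PAPER-2 track (ii): constants of the CSH family)

builds on p205010 (kernel theorem, internal audit signed; external expert review pending).  Support file (`--supports
stmt-CriticalPhenomena-4575`), seat `prim-consts-2` (gen 9); memo `run/shared/lean/prim/consts/FROM-prim-consts-2-g9-MDLXJOINT.md` §6.1.
No definitions, no named facts, no sorries.

* `Consts.mdlxJoint_of_markerMeasurable` — **THEOREM.**  For every finite weighted graph, all `s, y, z, X`, and every `φ : ℝ → ℝ → ℝ` that is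
  monotone on `{0,1}²` (`φ 0 0 ≤ φ 1 0 ≤ φ 1 1`, `φ 0 0 ≤ φ 0 1 ≤ φ 1 1`), the `Consts.MDLXJoint` inequality (observer constant
  `p' = P(y↔z | y↮{s}∪X, s↮X)`) holds for the functional `F(C) = φ(connIndicatorFn s y C, connIndicatorFn s z C)` of the edge cluster of `s`,
  i.e. for EVERY monotone functional of `C_s` that depends only on the marker pair `(1{y ∈ C_s}, 1{z ∈ C_s})`.
  Proof: `φ(p,q) = a + (m−a)·max(p,q) + (b−m)·p + (c−m)·q + (d−M)·pq` on `{0,1}²` (`a,b,c,d = φ00, φ10, φ01, φ11`, `m = min b c`, `M = max b c`,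
  all coefficients `≥ 0`), the inequality is linear in `F` and vanishes on constants, and the four indicator cases are
  `Consts.mdlxJoint_connIndicator` (`1{s↔y}`), `Consts.mdlx_marker_reach_le` (`1{s↔y ∨ s↔z}`, `1{s↔z}`) and `Consts.mdlx_marker_notReach_le` (`1{s↔y ∧ s↔z}`).
[cite: VandenbergHaggstromKahn2005, Thm. 1.3 (p. 6), Thm. 1.4 (p. 7) with Remark 1 after Thm. 1.2 (p. 5); KozmaNitzan2024 §2.2 p. 5]
-/

noncomputable section

namespace Summit.CriticalPhenomena.PercolationContinuityZ3.Theorems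

open MeasureTheory Set Literature.Probability.LatticeModels Literature.Probability.Percolation
open scoped Classical

namespace Consts

variable {V : Type*} [Fintype V]

omit [Fintype V] in
/-- The marker-measurable functional read on a configuration: the constant `φ 0 0` plus a combination (with coefficients that are nonnegative when
`φ` is monotone on `{0,1}²`) of the indicators of `{s↔y} ∪ {s↔z}`, `{s↔y}`, `{s↔z}`, `{s↔y} ∩ {s↔z}`. [folklore] -/
theorem markerFn_openEdgeCluster (φ : ℝ → ℝ → ℝ) (s y z : V) (ω : BondConfig V) :
    φ (connIndicatorFn s y (openEdgeCluster ω s)) (connIndicatorFn s z (openEdgeCluster ω s)) =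
      φ 0 0 + (min (φ 1 0) (φ 0 1) - φ 0 0) * (openConn s y ∪ openConn s z).indicator 1 ω +
        (φ 1 0 - min (φ 1 0) (φ 0 1)) * (openConn s y).indicator 1 ω +
        (φ 0 1 - min (φ 1 0) (φ 0 1)) * (openConn s z).indicator 1 ω +
        (φ 1 1 - max (φ 1 0) (φ 0 1)) * (openConn s y ∩ openConn s z).indicator 1 ω := by
  rw [connIndicatorFn_openEdgeCluster, connIndicatorFn_openEdgeCluster]
  have hmm := min_add_max (φ 1 0) (φ 0 1)
  by_cases hy : ω ∈ openConn s y <;> by_cases hz : ω ∈ openConn s z <;>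
    (simp [mem_union, mem_inter_iff, hy, hz]; try linarith)

/-- Set integrals of the marker-measurable functional. [folklore] -/
theorem setIntegral_markerFn (w : Sym2 V → unitInterval) (φ : ℝ → ℝ → ℝ) (s y z : V) (E : Set (BondConfig V)) :
    ∫ ω in E, φ (connIndicatorFn s y (openEdgeCluster ω s)) (connIndicatorFn s z (openEdgeCluster ω s)) ∂(prodBernoulli w) =
      φ 0 0 * (prodBernoulli w).real E +
        (min (φ 1 0) (φ 0 1) - φ 0 0) * (prodBernoulli w).real (E ∩ (openConn s y ∪ openConn s z)) +
        (φ 1 0 - min (φ 1 0) (φ 0 1)) * (prodBernoulli w).real (E ∩ openConn s y) +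
        (φ 0 1 - min (φ 1 0) (φ 0 1)) * (prodBernoulli w).real (E ∩ openConn s z) +
        (φ 1 1 - max (φ 1 0) (φ 0 1)) * (prodBernoulli w).real (E ∩ (openConn s y ∩ openConn s z)) := by
  classical
  have hmeas : ∀ S : Set (BondConfig V), MeasurableSet S := fun _ => MeasurableSet.of_discrete
  simp_rw [markerFn_openEdgeCluster]
  -- everything is a finite weighted sum
  rw [LonePortSum.setIntegral_eq_sum, LonePortSum.measureReal_eq_sum, LonePortSum.measureReal_eq_sum, LonePortSum.measureReal_eq_sum,
    LonePortSum.measureReal_eq_sum, LonePortSum.measureReal_eq_sum]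
  have hind : ∀ (S : Set (BondConfig V)) (ω : BondConfig V), S.indicator (1 : BondConfig V → ℝ) ω = DecisionTree.ind S ω := by
    intro S ω
    by_cases h : ω ∈ S
    · rw [indicator_of_mem h, DecisionTree.ind_of_mem h, Pi.one_apply]
    · rw [indicator_of_notMem h, DecisionTree.ind_of_not_mem h]
  simp only [hind, BHK2006.ind_inter, Finset.mul_sum, ← Finset.sum_add_distrib]
  refine Finset.sum_congr rfl fun ω _ => ?_
  ring

/-- The algebra behind `mdlxJoint_of_markerMeasurable`: the margin of `φ00 + c₁·1_{Y∪Z} + c₂·1_Y + c₃·1_Z + c₄·1_{Y∩Z}` is the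
coefficient-weighted sum of the four marker margins, each nonnegative given `ν(s↔z) ≥ p'ν(s↔y)` (`K1`), `ν(s↮z) ≥ p'ν(s↮y)` (`K2`) and the
marker theorem (`hY`). [folklore] -/
theorem mdlx_marker_algebra (a₀ c₁ c₂ c₃ c₄ aw bw d dy dz dv e dyc dzc : ℝ)
    (hc₁ : 0 ≤ c₁) (hc₂ : 0 ≤ c₂) (hc₃ : 0 ≤ c₃) (hc₄ : 0 ≤ c₄)
    (_haw : 0 ≤ aw) (hbw : 0 ≤ bw) (_hdy : 0 ≤ dy) (_hdz : 0 ≤ dz) (he : 0 ≤ e) (_hdyc : 0 ≤ dyc) (hdzc : 0 ≤ dzc)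
    (hsY : d = dy + dyc) (hsZ : d = dz + dzc) (hV : dv ≤ d) (hYZY : e ≤ dy)
    (K1 : bw * dy ≤ aw * dz) (K2 : bw * dyc ≤ aw * dzc) (hY : bw * dy * dyc ≤ aw * (d * e - dy * dz)) :
    bw * (d * (a₀ * dy + c₁ * dy + c₂ * dy + c₃ * e + c₄ * e) - (a₀ * d + c₁ * dv + c₂ * dy + c₃ * dz + c₄ * e) * dy) ≤
      aw * (d * (a₀ * dz + c₁ * dz + c₂ * e + c₃ * dz + c₄ * e) - (a₀ * d + c₁ * dv + c₂ * dy + c₃ * dz + c₄ * e) * dz) := by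
  have mV : 0 ≤ c₁ * (aw * (d * dz - dv * dz) - bw * (d * dy - dv * dy)) := by
    refine mul_nonneg hc₁ ?_
    have h1 : bw * dy * (d - dv) ≤ aw * dz * (d - dv) := mul_le_mul_of_nonneg_right K1 (sub_nonneg.2 hV)
    nlinarith [h1]
  have mY : 0 ≤ c₂ * (aw * (d * e - dy * dz) - bw * (d * dy - dy * dy)) := by
    refine mul_nonneg hc₂ ?_
    have h1 : bw * (d * dy - dy * dy) = bw * dy * dyc := by rw [hsY]; ring
    rw [h1]; linarith [hY]
  have mZ : 0 ≤ c₃ * (aw * (d * dz - dz * dz) - bw * (d * e - dz * dy)) := by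
    refine mul_nonneg hc₃ ?_
    have h5 : bw * (d * e) ≤ bw * (d * dy) := mul_le_mul_of_nonneg_left (mul_le_mul_of_nonneg_left hYZY (by rw [hsZ]; positivity)) hbw
    have h6 : bw * dy * dzc ≤ aw * dz * dzc := mul_le_mul_of_nonneg_right K1 hdzc
    have h7 : aw * (d * dz - dz * dz) = aw * dz * dzc := by rw [hsZ]; ring
    have h8 : bw * (d * dy) - bw * (dz * dy) = bw * dy * dzc := by rw [hsZ]; ring
    nlinarith [h5, h6, h7, h8]
  have mYZ : 0 ≤ c₄ * (aw * (d * e - e * dz) - bw * (d * e - e * dy)) := by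
    refine mul_nonneg hc₄ ?_
    have eq1 : bw * (d * e - e * dy) = e * (bw * dyc) := by rw [hsY]; ring
    have eq2 : aw * (d * e - e * dz) = e * (aw * dzc) := by rw [hsZ]; ring
    rw [eq1, eq2]
    exact sub_nonneg.2 (mul_le_mul_of_nonneg_left K2 he)
  have expand : aw * (d * (a₀ * dz + c₁ * dz + c₂ * e + c₃ * dz + c₄ * e) - (a₀ * d + c₁ * dv + c₂ * dy + c₃ * dz + c₄ * e) * dz) -
      bw * (d * (a₀ * dy + c₁ * dy + c₂ * dy + c₃ * e + c₄ * e) - (a₀ * d + c₁ * dv + c₂ * dy + c₃ * dz + c₄ * e) * dy) =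
      c₁ * (aw * (d * dz - dv * dz) - bw * (d * dy - dv * dy)) + c₂ * (aw * (d * e - dy * dz) - bw * (d * dy - dy * dy)) +
      c₃ * (aw * (d * dz - dz * dz) - bw * (d * e - dz * dy)) + c₄ * (aw * (d * e - e * dz) - bw * (d * e - e * dy)) := by ring
  rw [← sub_nonneg, expand]
  exact add_nonneg (add_nonneg (add_nonneg mV mY) mZ) mYZ

/-- **MDL(X)′ for every monotone marker-measurable functional.**  `D = {s↮X}`, `𝒜 = {y↮{s}∪X}`, `W = {y↔z}`; for `φ` monotone on `{0,1}²`
and `F = φ(connIndicatorFn s y ·, connIndicatorFn s z ·)`: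
`μ(𝒜∩D∩W)·[μ(D)∫_{D∩{s↔y}}F(C_s) − (∫_D F(C_s))μ(D∩{s↔y})] ≤ μ(𝒜∩D)·[μ(D)∫_{D∩{s↔z}}F(C_s) − (∫_D F(C_s))μ(D∩{s↔z})]`.
[cite: VandenbergHaggstromKahn2005, Thm. 1.3 (p. 6), Thm. 1.4 (p. 7), Remark 1 (p. 5) — corollary, derived here] -/
theorem mdlxJoint_of_markerMeasurable (w : Sym2 V → unitInterval) (s y z : V) (X : Set V) (φ : ℝ → ℝ → ℝ)
    (h00_10 : φ 0 0 ≤ φ 1 0) (h00_01 : φ 0 0 ≤ φ 0 1) (h10_11 : φ 1 0 ≤ φ 1 1) (h01_11 : φ 0 1 ≤ φ 1 1) :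
    (prodBernoulli w).real ({ω : BondConfig V | ∀ x ∈ insert s X, ¬ (openGraph ω).Reachable y x} ∩
          {ω | ∀ x ∈ X, ¬ (openGraph ω).Reachable s x} ∩ openConn y z) *
        ((prodBernoulli w).real {ω : BondConfig V | ∀ x ∈ X, ¬ (openGraph ω).Reachable s x} *
            (∫ ω in {ω : BondConfig V | ∀ x ∈ X, ¬ (openGraph ω).Reachable s x} ∩ openConn s y,
              φ (connIndicatorFn s y (openEdgeCluster ω s)) (connIndicatorFn s z (openEdgeCluster ω s)) ∂(prodBernoulli w)) -
          (∫ ω in {ω : BondConfig V | ∀ x ∈ X, ¬ (openGraph ω).Reachable s x},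
              φ (connIndicatorFn s y (openEdgeCluster ω s)) (connIndicatorFn s z (openEdgeCluster ω s)) ∂(prodBernoulli w)) *
            (prodBernoulli w).real ({ω : BondConfig V | ∀ x ∈ X, ¬ (openGraph ω).Reachable s x} ∩ openConn s y)) ≤
      (prodBernoulli w).real ({ω : BondConfig V | ∀ x ∈ insert s X, ¬ (openGraph ω).Reachable y x} ∩
          {ω | ∀ x ∈ X, ¬ (openGraph ω).Reachable s x}) *
        ((prodBernoulli w).real {ω : BondConfig V | ∀ x ∈ X, ¬ (openGraph ω).Reachable s x} *
            (∫ ω in {ω : BondConfig V | ∀ x ∈ X, ¬ (openGraph ω).Reachable s x} ∩ openConn s z,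
              φ (connIndicatorFn s y (openEdgeCluster ω s)) (connIndicatorFn s z (openEdgeCluster ω s)) ∂(prodBernoulli w)) -
          (∫ ω in {ω : BondConfig V | ∀ x ∈ X, ¬ (openGraph ω).Reachable s x},
              φ (connIndicatorFn s y (openEdgeCluster ω s)) (connIndicatorFn s z (openEdgeCluster ω s)) ∂(prodBernoulli w)) *
            (prodBernoulli w).real ({ω : BondConfig V | ∀ x ∈ X, ¬ (openGraph ω).Reachable s x} ∩ openConn s z)) := by
  classical
  have hmeas : ∀ S : Set (BondConfig V), MeasurableSet S := fun _ => MeasurableSet.of_discrete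
  rw [setIntegral_markerFn, setIntegral_markerFn, setIntegral_markerFn]
  have h0 : ∀ S : Set (BondConfig V), 0 ≤ (prodBernoulli w).real S := fun _ => measureReal_nonneg
  -- set simplifications
  have e1 : {ω : BondConfig V | ∀ x ∈ X, ¬ (openGraph ω).Reachable s x} ∩ openConn s y ∩ (openConn s y ∪ openConn s z) =
      {ω : BondConfig V | ∀ x ∈ X, ¬ (openGraph ω).Reachable s x} ∩ openConn s y := by rw [inter_assoc, inter_eq_left.2 subset_union_left]
  have e2 : {ω : BondConfig V | ∀ x ∈ X, ¬ (openGraph ω).Reachable s x} ∩ openConn s y ∩ openConn s y =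
      {ω : BondConfig V | ∀ x ∈ X, ¬ (openGraph ω).Reachable s x} ∩ openConn s y := by rw [inter_assoc, inter_self]
  have e3 : {ω : BondConfig V | ∀ x ∈ X, ¬ (openGraph ω).Reachable s x} ∩ openConn s y ∩ (openConn s y ∩ openConn s z) =
      {ω : BondConfig V | ∀ x ∈ X, ¬ (openGraph ω).Reachable s x} ∩ (openConn s y ∩ openConn s z) := by
    rw [inter_assoc, ← inter_assoc (openConn s y), inter_self]
  have e4 : {ω : BondConfig V | ∀ x ∈ X, ¬ (openGraph ω).Reachable s x} ∩ openConn s z ∩ (openConn s y ∪ openConn s z) =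
      {ω : BondConfig V | ∀ x ∈ X, ¬ (openGraph ω).Reachable s x} ∩ openConn s z := by rw [inter_assoc, inter_eq_left.2 subset_union_right]
  have e5 : {ω : BondConfig V | ∀ x ∈ X, ¬ (openGraph ω).Reachable s x} ∩ openConn s z ∩ openConn s z =
      {ω : BondConfig V | ∀ x ∈ X, ¬ (openGraph ω).Reachable s x} ∩ openConn s z := by rw [inter_assoc, inter_self]
  have e6 : {ω : BondConfig V | ∀ x ∈ X, ¬ (openGraph ω).Reachable s x} ∩ openConn s z ∩ (openConn s y ∩ openConn s z) =
      {ω : BondConfig V | ∀ x ∈ X, ¬ (openGraph ω).Reachable s x} ∩ (openConn s y ∩ openConn s z) := by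
    rw [inter_assoc, inter_comm (openConn s y) (openConn s z), ← inter_assoc (openConn s z), inter_self, inter_comm (openConn s z)]
  have e7 : {ω : BondConfig V | ∀ x ∈ X, ¬ (openGraph ω).Reachable s x} ∩ openConn s z ∩ openConn s y =
      {ω : BondConfig V | ∀ x ∈ X, ¬ (openGraph ω).Reachable s x} ∩ (openConn s y ∩ openConn s z) := by rw [inter_assoc, inter_comm (openConn s z)]
  have e8 : {ω : BondConfig V | ∀ x ∈ X, ¬ (openGraph ω).Reachable s x} ∩ openConn s y ∩ openConn s z =
      {ω : BondConfig V | ∀ x ∈ X, ¬ (openGraph ω).Reachable s x} ∩ (openConn s y ∩ openConn s z) := inter_assoc _ _ _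
  rw [e1, e2, e3, e4, e5, e6, e7, e8]
  -- the ingredients
  have hY := mdlxJoint_connIndicator w s y z X
  rw [e8] at hY
  have K1 := mdlx_marker_reach_le w s y z X
  have K2 := mdlx_marker_notReach_le w s y z X
  have hsY : (prodBernoulli w).real {ω : BondConfig V | ∀ x ∈ X, ¬ (openGraph ω).Reachable s x} =
      (prodBernoulli w).real ({ω : BondConfig V | ∀ x ∈ X, ¬ (openGraph ω).Reachable s x} ∩ openConn s y) +
      (prodBernoulli w).real ({ω : BondConfig V | ∀ x ∈ X, ¬ (openGraph ω).Reachable s x} ∩ (openConn s y)ᶜ) := by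
    rw [← Set.sdiff_eq]; exact (measureReal_inter_add_sdiff (μ := prodBernoulli w) (s := {ω : BondConfig V | ∀ x ∈ X, ¬ (openGraph ω).Reachable s x}) (hmeas (openConn s y))).symm
  have hsZ : (prodBernoulli w).real {ω : BondConfig V | ∀ x ∈ X, ¬ (openGraph ω).Reachable s x} =
      (prodBernoulli w).real ({ω : BondConfig V | ∀ x ∈ X, ¬ (openGraph ω).Reachable s x} ∩ openConn s z) +
      (prodBernoulli w).real ({ω : BondConfig V | ∀ x ∈ X, ¬ (openGraph ω).Reachable s x} ∩ (openConn s z)ᶜ) := by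
    rw [← Set.sdiff_eq]; exact (measureReal_inter_add_sdiff (μ := prodBernoulli w) (s := {ω : BondConfig V | ∀ x ∈ X, ¬ (openGraph ω).Reachable s x}) (hmeas (openConn s z))).symm
  have hV : (prodBernoulli w).real ({ω : BondConfig V | ∀ x ∈ X, ¬ (openGraph ω).Reachable s x} ∩ (openConn s y ∪ openConn s z)) ≤
      (prodBernoulli w).real {ω : BondConfig V | ∀ x ∈ X, ¬ (openGraph ω).Reachable s x} := measureReal_mono inter_subset_left
  have hYZY : (prodBernoulli w).real ({ω : BondConfig V | ∀ x ∈ X, ¬ (openGraph ω).Reachable s x} ∩ (openConn s y ∩ openConn s z)) ≤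
      (prodBernoulli w).real ({ω : BondConfig V | ∀ x ∈ X, ¬ (openGraph ω).Reachable s x} ∩ openConn s y) :=
    measureReal_mono fun ω hω => ⟨hω.1, hω.2.1⟩
  exact mdlx_marker_algebra _ _ _ _ _ _ _ _ _ _ _ _ _ _
    (sub_nonneg.2 (le_min h00_10 h00_01)) (sub_nonneg.2 (min_le_left _ _)) (sub_nonneg.2 (min_le_right _ _))
    (sub_nonneg.2 (max_le h10_11 h01_11)) (h0 _) (h0 _) (h0 _) (h0 _) (h0 _) (h0 _) (h0 _) hsY hsZ hV hYZY K1 K2 hY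

end Consts

end Summit.CriticalPhenomena.PercolationContinuityZ3.Theorems

end
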